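import Summits.Ventures.HSemireg.ObstructionLocusBlockNormal

/-!
# Venture HSemireg — (S5) OBSTRUCTION LOCUS away from secant type, XX: the BLOCK MODELS `M(S_1, …, S_r)` —
# the tangent-to-normal dictionary `π : Der_K(R) → Hom_R(I_M, R/I_M)`: **`π(∂_c)` is the unit normal field on every
# branch `V(x_a, x_c) × 𝔸` through `x_c`** (branch coordinates `δ_{b c}`)

HONEST FRAMING.  Companion of `ObstructionLocusBlockNormal.lean` (cell `pub-hsemireg`, track «S4-PUSH» (ii), seat
s4-prove-2; vocabulary and honest framing as there): plain commutative algebra in `R = MvPolynomial (Fin n) K`, `K` any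
commutative ring; nothing here constructs a variety or a sheaf; nothing here says that HC / HC_CM / HC_AV holds; no
Literature fact is declared or used.  This is the block-model form of file IX's last section («`π(∂_l) = Σ_{k ≠ l}
E_{kl}`», G2-REDUCIBLE-POINT §2 L1 (i), last line): the affine model of `π : T_X → N′_Z` («restrict the constant
vector field to the branches»), whose cokernel bookkeeping is the Kodaira piece of file II at a crossing point.

* `derivToNormal B θ : I_M →ₗ[R] R/I_M`, `u ↦ θ(u) mod I_M` (`R`-linear: the Leibniz defect `u · θ(r)` lies in `I_M`).
* `pderiv_gen_partner` (`∂_c gen i a = genPartner i a c` for `c ∈ S_i ∖ a`), `pderiv_gen_self` (`∂_a gen i a = 0`),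
  `pderiv_gen_mem_blockIdeal` (`∂_c gen j a ∈ I_{S_j}` for `c ∉ S_j`).
* **`rho_derivToNormal_pderiv`**: the branch coordinates of `π(∂_c)` are `ρ(π(∂_c))(j, a, b) = δ_{b c}` — `1` on the
  branches `V(x_a, x_c) × 𝔸` of the block containing `c` (seen on the generator `a`), `0` on every other branch;
  **`derivToNormal_pderiv_eq_tau`**: `π(∂_c) = τ(δ_{· c}) = Σ_{a ∈ S_i ∖ c} σ_{i,a,c}(1)`.
* `derivation_eq_sum_smul_pderiv` (`θ = Σ_c θ(x_c) ∂_c`), **`rho_derivToNormal`**: for EVERY `K`-derivation `θ`,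
  `ρ(π(θ))(i, a, b) = θ(x_b) mod (x_b, x_a)` — EXT-NOTE §6.B(a)'s `ρ(φ)_B = (φ(x_a)|_B, φ(x_b)|_B)` on `φ = π(θ)`;
  **`derivToNormal_eq_tau`**: `π(θ) = τ(t ↦ θ(x_{t.b})|_{B_t})`.
SCOPE PRECISIONS (s4-ref P-1/P-2 on file XIX, recorded here): blocks of size `1` are allowed by `Blocks` but are
VACUOUS (`I_{{a}} = R`, no branch datum) — the gloss «block = component family `K_{S_i} × 𝔸`, `#Branch = 2 ·
#components`» is meant for `|S_i| ≥ 2`; and «every point of a (GEN) arrangement» means the affine model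
`(𝔸ⁿ, M)_0` — for `Z_T` itself only modulo the étale-local passage, which stays prose.
References (dictionary only): G2-REDUCIBLE-POINT-THEOREM.md §1–§2 (`π : T_X → N′`); EXT-NOTE.md §6.B(a), §6.C.
-/

open scoped BigOperators
open MvPolynomial Finset

namespace Summit.Ventures.HSemireg.ObstructionLocus.BlockModel

variable {K : Type*} [CommRing K] {n : ℕ} {ι : Type*}

/-! ## `π(θ) : I_M → R/I_M` -/

/-- `π(θ) : I_M → R/I_M`, `u ↦ θ(u) mod I_M`, for a `K`-derivation `θ` of `R` — `R`-linear because `u ∈ I_M` kills the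
Leibniz defect `u · θ(r)`. -/
noncomputable def derivToNormal (B : Blocks ι n) (θ : Derivation K (MvPolynomial (Fin n) K) (MvPolynomial (Fin n) K)) :
    ↥(arrIdeal K B) →ₗ[MvPolynomial (Fin n) K] MvPolynomial (Fin n) K ⧸ arrIdeal K B where
  toFun u := Ideal.Quotient.mk (arrIdeal K B) (θ u.1)
  map_add' u v := by
    simp only [Submodule.coe_add, map_add]
  map_smul' r u := by
    change Ideal.Quotient.mk _ (θ (r * u.1)) = r • Ideal.Quotient.mk _ (θ u.1)
    rw [Derivation.leibniz, smul_eq_mul, smul_eq_mul, map_add, map_mul, map_mul,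
      Ideal.Quotient.eq_zero_iff_mem.2 u.2, zero_mul, add_zero, smul_mk_eq, map_mul]

/-- `π(θ)` on an element of `I_M`. -/
theorem derivToNormal_apply (B : Blocks ι n) (θ : Derivation K (MvPolynomial (Fin n) K) (MvPolynomial (Fin n) K))
    (u : ↥(arrIdeal K B)) : derivToNormal B θ u = Ideal.Quotient.mk (arrIdeal K B) (θ u.1) := rfl

/-! ## `∂_c` on the square-free monomials and on the test elements -/

/-- `∂_c x_T = 0` for `c ∉ T`. -/
theorem pderiv_sq_of_notMem {T : Finset (Fin n)} {c : Fin n} (hc : c ∉ T) :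
    pderiv c (sq T : MvPolynomial (Fin n) K) = 0 := by
  rw [sq_eq_monomial, pderiv_monomial, ind_apply_of_notMem hc, Nat.cast_zero, mul_zero, monomial_zero]

/-- `∂_c x_T = x_{T ∖ c}` for `c ∈ T`. -/
theorem pderiv_sq_of_mem {T : Finset (Fin n)} {c : Fin n} (hc : c ∈ T) :
    pderiv c (sq T : MvPolynomial (Fin n) K) = sq (T.erase c) := by
  rw [sq_eq_monomial, pderiv_monomial, ind_apply_of_mem hc, Nat.cast_one, mul_one, ind_eq_single_add_erase hc,
    add_tsub_cancel_left, sq_eq_monomial]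

/-! ## Linearity of `π` in `θ`, and `θ = Σ_c θ(x_c) ∂_c` -/

/-- `π` is additive in `θ`. -/
theorem derivToNormal_add (B : Blocks ι n) (θ θ' : Derivation K (MvPolynomial (Fin n) K) (MvPolynomial (Fin n) K)) :
    derivToNormal B (θ + θ') = derivToNormal B θ + derivToNormal B θ' := by
  apply LinearMap.ext
  intro u
  rw [LinearMap.add_apply, derivToNormal_apply, derivToNormal_apply, derivToNormal_apply, Derivation.add_apply,
    map_add]

/-- `π` is `R`-homogeneous in `θ`. -/
theorem derivToNormal_smul (B : Blocks ι n) (r : MvPolynomial (Fin n) K)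
    (θ : Derivation K (MvPolynomial (Fin n) K) (MvPolynomial (Fin n) K)) :
    derivToNormal B (r • θ) = r • derivToNormal B θ := by
  apply LinearMap.ext
  intro u
  rw [LinearMap.smul_apply, derivToNormal_apply, derivToNormal_apply, Derivation.smul_apply, smul_mk_eq,
    smul_eq_mul]

/-- `π` of a finite sum of derivations. -/
theorem derivToNormal_sum (B : Blocks ι n) {α : Type*} (s : Finset α)
    (θ : α → Derivation K (MvPolynomial (Fin n) K) (MvPolynomial (Fin n) K)) :
    derivToNormal B (∑ x ∈ s, θ x) = ∑ x ∈ s, derivToNormal B (θ x) := by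
  classical
  induction s using Finset.induction_on with
  | empty =>
    rw [Finset.sum_empty, Finset.sum_empty]
    apply LinearMap.ext
    intro u
    rw [derivToNormal_apply, Derivation.zero_apply, map_zero, LinearMap.zero_apply]
  | insert x s hx ih => rw [Finset.sum_insert hx, Finset.sum_insert hx, derivToNormal_add, ih]

/-- A finite sum of derivations, applied. -/
theorem sum_derivation_apply {α : Type*} (s : Finset α)
    (θ : α → Derivation K (MvPolynomial (Fin n) K) (MvPolynomial (Fin n) K)) (p : MvPolynomial (Fin n) K) :
    (∑ x ∈ s, θ x) p = ∑ x ∈ s, θ x p := by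
  classical
  induction s using Finset.induction_on with
  | empty => rw [Finset.sum_empty, Finset.sum_empty, Derivation.zero_apply]
  | insert x s hx ih => rw [Finset.sum_insert hx, Finset.sum_insert hx, Derivation.add_apply, ih]

/-- Every `K`-derivation of `R = K[x_1, …, x_n]` is `Σ_c θ(x_c) · ∂_c`. -/
theorem derivation_eq_sum_smul_pderiv (θ : Derivation K (MvPolynomial (Fin n) K) (MvPolynomial (Fin n) K)) :
    θ = ∑ c : Fin n, θ (X c) • (pderiv c : Derivation K (MvPolynomial (Fin n) K) (MvPolynomial (Fin n) K)) := by
  classical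
  apply derivation_ext
  intro i
  rw [sum_derivation_apply, Finset.sum_eq_single i]
  · rw [Derivation.smul_apply, pderiv_X, Pi.single_eq_same, smul_eq_mul, mul_one]
  · intro c _ hc
    rw [Derivation.smul_apply, pderiv_X, Pi.single_eq_of_ne' hc, smul_zero]
  · intro h
    exact absurd (Finset.mem_univ i) h

variable [Fintype ι] [DecidableEq ι]

/-- `∂_c gen i a = genPartner i a c` for `c ∈ S_i ∖ a` (the same finset identity as `dropDiv_gen_self`). -/
theorem pderiv_gen_partner (B : Blocks ι n) {i : ι} {a c : Fin n} (hc : c ∈ (B.S i).erase a) :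
    pderiv c (gen B i a : MvPolynomial (Fin n) K) = genPartner B i a c := by
  rw [gen, pderiv_sq_of_mem (mem_union_left _ hc), genPartner, Finset.erase_union_distrib,
    Finset.erase_eq_of_notMem (B.notMem_rest (mem_erase.1 hc).2)]

/-- `∂_a gen i a = 0` (`x_a` does not occur in `gen i a`). -/
theorem pderiv_gen_self (B : Blocks ι n) {i : ι} {a : Fin n} (ha : a ∈ B.S i) :
    pderiv a (gen B i a : MvPolynomial (Fin n) K) = 0 := by
  refine pderiv_sq_of_notMem ?_
  rw [mem_union, not_or]
  exact ⟨Finset.notMem_erase a _, B.notMem_rest ha⟩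

/-- `∂_c gen j a ∈ I_{S_j}` when `c ∉ S_j` (the generator factor `x_{S_j ∖ a}` survives). -/
theorem pderiv_gen_mem_blockIdeal (B : Blocks ι n) {j : ι} {a c : Fin n} (ha : a ∈ B.S j) (hc : c ∉ B.S j) :
    pderiv c (gen B j a : MvPolynomial (Fin n) K) ∈ blockIdeal K (B.S j) := by
  by_cases hcT : c ∈ (B.S j).erase a ∪ B.rest j
  · rw [gen, pderiv_sq_of_mem hcT, sq_eq_monomial]
    refine monomial_mem_blockIdeal ⟨a, ha, fun d hd => ?_⟩ 1
    rw [support_ind]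
    refine mem_erase.2 ⟨?_, mem_union_left _ hd⟩
    rintro rfl
    exact hc (mem_erase.1 hd).2
  · rw [gen, pderiv_sq_of_notMem hcT]
    exact Submodule.zero_mem _

/-! ## The branch coordinates of `π(∂_c)` -/

/-- **`ρ(π(∂_c))(j, a, b) = δ_{b c}`**: the constant vector field `∂_c` (with `c` in block `i`, say) has branch
coordinate `1` on each branch `V(x_a, x_c) × 𝔸`, `a ∈ S_i ∖ c`, seen on the generator `a`, and `0` on every other
branch datum — of block `i` (generator `c` itself, or partner `b ≠ c`) or of any other block (there `∂_c` is tangent).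
This is file IX's «`π(∂_l) = Σ_{k ≠ l} E_{kl}`» for every block model. -/
theorem rho_derivToNormal_pderiv (B : Blocks ι n) (c : Fin n) (t : Branch B) :
    rho (K := K) B (derivToNormal B (pderiv c)) t = if t.1.2.2 = c then 1 else 0 := by
  classical
  obtain ⟨⟨j, a, b⟩, ha, hb⟩ := t
  rw [rho_apply]
  dsimp only at ha hb ⊢
  have hbS : b ∈ B.S j := (mem_erase.1 hb).2
  by_cases hcj : c ∈ B.S j
  · by_cases hac : a = c
    · -- the generator `c` itself: `∂_c gen j c = 0`
      subst hac
      have key : toBlock B j (derivToNormal (K := K) B (pderiv a)) ⟨gen B j a, gen_mem B ha⟩ = branchMapV B j a 0 := by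
        rw [map_zero, toBlock_apply, derivToNormal_apply, pderiv_gen_self B ha, map_zero, map_zero]
      rw [rhoLoc_apply_of_eq B ⟨a, ha⟩ key, if_neg (mem_erase.1 hb).1]
      exact map_zero _
    · have hc' : c ∈ (B.S j).erase a := mem_erase.2 ⟨fun h => hac h.symm, hcj⟩
      have key : toBlock B j (derivToNormal (K := K) B (pderiv c)) ⟨gen B j a, gen_mem B ha⟩
          = branchMapV B j a (Pi.single (⟨c, hc'⟩ : ↥((B.S j).erase a)) 1) := by
        rw [toBlock_apply, derivToNormal_apply, pderiv_gen_partner B hc', factor_mk, branchMapV_single]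
      rw [rhoLoc_apply_of_eq B ⟨a, ha⟩ key]
      dsimp only
      by_cases hbc : b = c
      · subst hbc
        rw [if_pos rfl, Pi.single_eq_same, map_one]
      · have hne : (⟨b, hb⟩ : ↥((B.S j).erase a)) ≠ ⟨c, hc'⟩ := fun h => hbc (congr_arg Subtype.val h)
        rw [if_neg hbc, Pi.single_eq_of_ne hne, map_zero]
  · -- `c` not in block `j`: `∂_c` is tangent to every branch of block `j`
    have key : toBlock B j (derivToNormal (K := K) B (pderiv c)) ⟨gen B j a, gen_mem B ha⟩ = branchMapV B j a 0 := by
      rw [map_zero, toBlock_apply, derivToNormal_apply, factor_mk, Ideal.Quotient.eq_zero_iff_mem]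
      exact pderiv_gen_mem_blockIdeal B ha hcj
    have hbc : b ≠ c := fun h => hcj (h ▸ hbS)
    rw [rhoLoc_apply_of_eq B ⟨a, ha⟩ key, if_neg hbc]
    exact map_zero _

/-- **`π(∂_c) = τ(δ_{· c}) = Σ_{a ∈ S_i ∖ c} σ_{i,a,c}(1)`**: the constant field `∂_c` IS the sum of the unit branch
fields of the branches through `x_c` — «restrict the normal field to the branches», block-model form. -/
theorem derivToNormal_pderiv_eq_tau (B : Blocks ι n) (c : Fin n) :
    derivToNormal (K := K) B (pderiv c) = tau B (fun t : Branch B => if t.1.2.2 = c then 1 else 0) := by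
  apply rho_injective B
  rw [rho_tau]
  funext t
  exact rho_derivToNormal_pderiv B c t

/-! ## Every derivation: the branch coordinate of `π(θ)` on `V(x_a, x_b) × 𝔸` is `θ(x_b)|_B` -/

/-- **For EVERY `K`-derivation `θ` of `R`: the branch coordinate of `π(θ)` at `(i, a, b)` is `θ(x_b) mod (x_b, x_a)`**
— EXT-NOTE §6.B(a)'s `ρ(φ)_B = (φ(x_a)|_B, φ(x_b)|_B)` evaluated on `φ = π(θ)`: the normal component of a vector field
along the branch `V(x_a, x_b) × 𝔸` is its `x_b`-component restricted to the branch. -/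
theorem rho_derivToNormal (B : Blocks ι n) (θ : Derivation K (MvPolynomial (Fin n) K) (MvPolynomial (Fin n) K))
    (t : Branch B) :
    rho B (derivToNormal B θ) t = Ideal.Quotient.mk _ (θ (X t.1.2.2)) := by
  classical
  conv_lhs => rw [derivation_eq_sum_smul_pderiv θ]
  rw [derivToNormal_sum, map_sum, Finset.sum_apply]
  simp_rw [derivToNormal_smul, map_smul, Pi.smul_apply, rho_derivToNormal_pderiv, smul_ite, smul_zero]
  rw [Finset.sum_ite_eq, if_pos (Finset.mem_univ _)]
  change _ • Ideal.Quotient.mk _ 1 = _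
  rw [smul_mk_eq, mul_one]

/-- Equivalently **`π(θ) = τ(t ↦ θ(x_{t.b}) mod (x_b, x_a))`** — every `π(θ)` is the sum over the branches of
«`x_b`-component of `θ` restricted to the branch» times the unit branch field. -/
theorem derivToNormal_eq_tau (B : Blocks ι n) (θ : Derivation K (MvPolynomial (Fin n) K) (MvPolynomial (Fin n) K)) :
    derivToNormal B θ = tau B (fun t : Branch B => Ideal.Quotient.mk _ (θ (X t.1.2.2))) := by
  apply rho_injective B
  rw [rho_tau]
  funext t
  exact rho_derivToNormal B θ t

end Summit.Ventures.HSemireg.ObstructionLocus.BlockModel
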